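import Mathlib
import HarnessLib
import Summits.QuantumFields.YangMills.Theorems.HypercubicLimit.Negative.ReflectedDensity
import Summits.QuantumFields.YangMills.Theorems.FradkinShenkerFlowFiniteSusceptibilityWeakCouplingRPCauchySchwarz
import Summits.QuantumFields.YangMills.Theorems.LangevinControlUVOSLegsFromFemtoAndGapStubAssemblyLatticeDist
import Summits.QuantumFields.YangMills.Theorems.LangevinControlUVOSLegsFromFemtoAndGapStubAssemblyShiftDefect
import Summits.QuantumFields.YangMills.Theorems.LangevinControlUVOSLegsFromFemtoAndGapStubUpgrade
import Summits.QuantumFields.YangMills.Theorems.PencilRigidityHypercubicLimitRpBlockBoundarySlice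
import Literature.MathematicalPhysics.AQFT.OSAxiomsSchwinger
import Literature.MathematicalPhysics.QuantumFieldTheory.OSData
import Literature.MathematicalPhysics.QuantumLattice.LatticeScalarField
import Literature.MathematicalPhysics.QuantumLattice.SchwartzNuclearExpansionBounds
import Literature.MathematicalPhysics.QuantumFieldTheory.LatticeGaugeStaticPotentialProofs
import Literature.Probability.LatticeModels.ThermodynamicLimit

/-!
# Block SAME-LIMIT-SMEARED of line `conditional-mean-telescoping` (crux stmt-QuantumFields-8646)

For abstract real weights `W` on multi-indices `x : Fin n → ℤ⁴` with sup bound `|W x| ≤ Mⁿ`, spacing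
`0 < a ≤ 1`, half-side `L ≥ a⁻²`, a sub-domain `D` of the box `B = (box 4 L)ⁿ` whose complement lies in
the far zone, a constant shift `c` with `‖c l‖ ≤ a`, `F ∈ ⁰𝒮ₙ`, and the SMEARED shifted uniform bound
`‖∑_{x ∈ B} W(x) G(y(x))‖ ≤ Φ |G|_s` for every `G ∈ ⁰𝒮ₙ` and every evaluation map `y` within `a` of the
scaled sites, the RP-adapted sum over `D` at the shifted points minus the canonical sum over `B` is `O(a)`:

`‖∑_{x ∈ D} W F(a x + c) − ∑_{x ∈ B} W F(a x)‖ ≤ a (2 Φ |F|_{s+1} + Mⁿ 2^{16n+2} Zⁿ 4^{10n+1} |F|_{10n+1})`.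

Proof.  Split the difference as `∑_{x ∈ B} W (F(a x + c) − F(a x)) − ∑_{x ∈ B ∖ D} W F(a x + c)`.
SHIFT PART: `W` is real, so the real part of the first sum is `∑ W(x) (Re F(a x + c) − Re F(a x))`;
by the mean value theorem (`exists_re_sub_eq_re_lineDeriv`) each difference is `Re ∂_c F` at an
intermediate point `a x + τ₁(x) c`, which is within `a` of `a x`; hence the real part is the real part of
`∑ W(x) (∂_c F)(y₁(x))`, bounded by `Φ |∂_c F|_s` by the smeared bound (`∂_c F ∈ ⁰𝒮ₙ` by
`IsOffDiagonal.lineDeriv`); the same for the imaginary part, and `|∂_c F|_s ≤ ‖c‖ |F|_{s+1} ≤ a |F|_{s+1}`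
(`seminorm_lineDeriv_le`).  SLICE PART: `F(a x + c) = F_c(a x)` with the translate
`F_c = compSubConstCLM ℂ (−c) F`; the landed block `rpBlock_boundarySlice` bounds the slice sum by
`Mⁿ 2^{16n+2} Zⁿ |F_c|_{10n+1,0} a`, and `|F_c|_{10n+1,0} ≤ |F_c|_{10n+1} ≤ (2(1+‖c‖))^{10n+1} |F|_{10n+1}
≤ 4^{10n+1} |F|_{10n+1}` (`schwartzNorm_compSubConstCLM_le`, `‖c‖ ≤ a ≤ 1`).
-/

noncomputable section

open scoped SchwartzMap ComplexConjugate
open MeasureTheory Filter Topology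
open Literature.MathematicalPhysics.AQFT Literature.MathematicalPhysics.QuantumLattice
open Literature.MathematicalPhysics.QuantumFieldTheory
open Literature.Probability.LatticeModels (box Site)
open Summit.QuantumFields.YangMills.Theorems.HypercubicLimit.Negative (torusPlaquette thetaZ)
open Summit.QuantumFields.YangMills.Theorems.OSLegsFromFemtoAndGap (latticeDist torusMoment)

namespace Summit.QuantumFields.YangMills.Cruxes.HypercubicLimit.ConditionalMeanTelescoping

/-- (auxiliary, block SAME-LIMIT-SMEARED) **Schwartz norms of a directional derivative.**
`|∂_e G|_s ≤ ‖e‖ |G|_{s+1}`: each seminorm `p_{k,l}(∂_e G) ≤ ‖e‖ p_{k,l+1}(G)` (`seminorm_lineDeriv_le`)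
and `p_{k,l+1} ≤ |·|_{s+1}` for `k, l ≤ s`. [folklore] -/
theorem slS_schwartzNorm_lineDeriv_le {V : Type*} [NormedAddCommGroup V] [NormedSpace ℝ V]
    (s : ℕ) (G : 𝓢(V, ℂ)) (e : V) :
    schwartzNorm s (LineDeriv.lineDerivOp e G : 𝓢(V, ℂ)) ≤ ‖e‖ * schwartzNorm (s + 1) G := by
  refine Seminorm.finset_sup_apply_le (mul_nonneg (norm_nonneg e) (schwartzNorm_nonneg _ _))
    fun i hi => ?_
  obtain ⟨hk, hl⟩ := Prod.mk_le_mk.1 (Finset.mem_Iic.1 hi)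
  rw [SchwartzMap.schwartzSeminormFamily_apply]
  calc SchwartzMap.seminorm ℂ i.1 i.2 (LineDeriv.lineDerivOp e G : 𝓢(V, ℂ))
      ≤ ‖e‖ * SchwartzMap.seminorm ℂ i.1 (i.2 + 1) G :=
        Summit.QuantumFields.YangMills.Theorems.OSLegsFromFemtoAndGap.seminorm_lineDeriv_le G e i.1 i.2
    _ ≤ ‖e‖ * schwartzNorm (s + 1) G :=
        mul_le_mul_of_nonneg_left
          (seminorm_le_schwartzNorm (Nat.le_succ_of_le hk) (Nat.succ_le_succ hl) G) (norm_nonneg e)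

/-- (auxiliary, block SAME-LIMIT-SMEARED) **Sup seminorm of a short translate.** For `‖v‖ ≤ 1`,
`|F(· − v)|_{m,0} ≤ |F(· − v)|_m ≤ (2(1 + ‖v‖))^m |F|_m ≤ 4^m |F|_m`
(`schwartzNorm_compSubConstCLM_le`). [folklore] -/
theorem slS_seminorm_translate_le {V : Type*} [NormedAddCommGroup V] [NormedSpace ℝ V]
    (m : ℕ) (F : 𝓢(V, ℂ)) {v : V} (hv : ‖v‖ ≤ 1) :
    SchwartzMap.seminorm ℂ m 0 (SchwartzMap.compSubConstCLM ℂ v F) ≤ 4 ^ m * schwartzNorm m F := by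
  calc SchwartzMap.seminorm ℂ m 0 (SchwartzMap.compSubConstCLM ℂ v F)
      ≤ schwartzNorm m (SchwartzMap.compSubConstCLM ℂ v F) :=
        seminorm_le_schwartzNorm le_rfl (Nat.zero_le m) _
    _ ≤ (2 * (1 + ‖v‖)) ^ m * schwartzNorm m F :=
        NuclearExpansion.schwartzNorm_compSubConstCLM_le m v F
    _ ≤ 4 ^ m * schwartzNorm m F := by
        refine mul_le_mul_of_nonneg_right ?_ (schwartzNorm_nonneg _ _)
        exact pow_le_pow_left₀ (by positivity) (by linarith) m

/-- **Block SAME-LIMIT-SMEARED (RP-adapted minus canonical is `O(a)` under a smeared shifted uniform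
bound).** For abstract real weights with sup bound `Mⁿ`, a sub-domain `D` of the box whose complement
lies in the far zone, a constant shift `c` with `‖c l‖ ≤ a ≤ 1`, `F ∈ ⁰𝒮ₙ`, and the SMEARED bound
`‖∑_{x ∈ box} W(x) G(y(x))‖ ≤ Φ |G|_s` for every `G ∈ ⁰𝒮ₙ` and every evaluation map `y` within `a` of the
scaled sites: `‖∑_{x∈D} W F(a x + c) − ∑_{x∈box} W F(a x)‖ ≤ a (2 Φ |F|_{s+1} + Mⁿ 2^{16n+2} Zⁿ 4^{10n+1} |F|_{10n+1})`
(mean value theorem at intermediate points for real and imaginary parts, `∂_c F ∈ ⁰𝒮ₙ` with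
`|∂_c F|_s ≤ ‖c‖ |F|_{s+1}`, plus `rpBlock_boundarySlice` for the translate `F(· + c)`). -/
theorem rpBlock_sameLimitSmeared :
    ∀ (n L s : ℕ) (M a Φ : ℝ) (W : (Fin n → Site 4) → ℝ) (D : Finset (Fin n → Site 4))
      (c : Fin n → EuclideanSpace ℝ (Fin 4)) (F : 𝓢((Fin n → EuclideanSpace ℝ (Fin 4)), ℂ)),
      0 ≤ M → (∀ x, |W x| ≤ M ^ n) → 0 < a → a ≤ 1 → a⁻¹ * a⁻¹ ≤ L → 0 ≤ Φ →
      D ⊆ Fintype.piFinset (fun _ : Fin n => box 4 L) →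
      (∀ x ∈ Fintype.piFinset (fun _ : Fin n => box 4 L), x ∉ D → ∃ l, (L : ℝ) ≤ ‖x l‖) →
      (∀ l, ‖c l‖ ≤ a) → IsOffDiagonal F →
      (∀ (y : (Fin n → Site 4) → (Fin n → EuclideanSpace ℝ (Fin 4))),
        (∀ x l, ‖y x l - a • siteToE (x l)‖ ≤ a) →
          ∀ G : 𝓢((Fin n → EuclideanSpace ℝ (Fin 4)), ℂ), IsOffDiagonal G →
            ‖∑ x ∈ Fintype.piFinset (fun _ : Fin n => box 4 L), ((W x : ℝ) : ℂ) * G (y x)‖ ≤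
              Φ * schwartzNorm s G) →
        ‖(∑ x ∈ D, ((W x : ℝ) : ℂ) * F (fun l => a • siteToE (x l) + c l)) -
            ∑ x ∈ Fintype.piFinset (fun _ : Fin n => box 4 L), ((W x : ℝ) : ℂ) * F (fun l => a • siteToE (x l))‖ ≤
          a * (2 * Φ * schwartzNorm (s + 1) F +
            M ^ n * 2 ^ (16 * n + 2) * (81 * ∑' j : ℕ, (((j : ℝ) + 1) ^ 2)⁻¹) ^ n * 4 ^ (10 * n + 1) *
              schwartzNorm (10 * n + 1) F) := by
  intro n L s M a Φ W D c F hM hW ha ha1 hLa hΦ hD hfar hc hF hU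
  classical
  -- abbreviations
  set B := Fintype.piFinset (fun _ : Fin n => box 4 L) with hB
  set ax : (Fin n → Site 4) → (Fin n → EuclideanSpace ℝ (Fin 4)) := fun x l => a • siteToE (x l) with hax
  set Z : ℝ := 81 * ∑' j : ℕ, (((j : ℝ) + 1) ^ 2)⁻¹ with hZ
  obtain ⟨F', hF'⟩ : ∃ F' : 𝓢((Fin n → EuclideanSpace ℝ (Fin 4)), ℂ), F' = LineDeriv.lineDerivOp c F :=
    ⟨_, rfl⟩
  obtain ⟨Fc, hFc⟩ : ∃ Fc : 𝓢((Fin n → EuclideanSpace ℝ (Fin 4)), ℂ),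
      Fc = SchwartzMap.compSubConstCLM ℂ (-c) F := ⟨_, rfl⟩
  have hZ0 : 0 ≤ Z := by
    rw [hZ]; exact mul_nonneg (by norm_num) (tsum_nonneg fun j => by positivity)
  have hsN0 : 0 ≤ schwartzNorm (s + 1) F := schwartzNorm_nonneg _ _
  -- the shift vector is short
  have hcn : ‖c‖ ≤ a := (pi_norm_le_iff_of_nonneg ha.le).2 hc
  have hcn1 : ‖-c‖ ≤ 1 := by rw [norm_neg]; exact hcn.trans ha1
  -- restate the goal with the abbreviations
  change ‖(∑ x ∈ D, ((W x : ℝ) : ℂ) * F (ax x + c)) - ∑ x ∈ B, ((W x : ℝ) : ℂ) * F (ax x)‖ ≤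
    a * (2 * Φ * schwartzNorm (s + 1) F +
      M ^ n * 2 ^ (16 * n + 2) * Z ^ n * 4 ^ (10 * n + 1) * schwartzNorm (10 * n + 1) F)
  -- the intermediate points of the mean value theorem, chosen per multi-index
  have hre : ∀ x : Fin n → Site 4, ∃ τ ∈ Set.Ioo (0 : ℝ) 1,
      (F (ax x + c)).re - (F (ax x)).re = (F' (ax x + τ • c)).re := by
    intro x
    rw [hF']
    exact Summit.QuantumFields.YangMills.Theorems.OSLegsFromFemtoAndGap.exists_re_sub_eq_re_lineDeriv
      F (ax x) c
  have him : ∀ x : Fin n → Site 4, ∃ τ ∈ Set.Ioo (0 : ℝ) 1,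
      (F (ax x + c)).im - (F (ax x)).im = (F' (ax x + τ • c)).im := by
    intro x
    rw [hF']
    exact Summit.QuantumFields.YangMills.Theorems.OSLegsFromFemtoAndGap.exists_im_sub_eq_im_lineDeriv
      F (ax x) c
  choose τ₁ hτ₁ hτ₁eq using hre
  choose τ₂ hτ₂ hτ₂eq using him
  -- the translate evaluated at the scaled sites
  have hFc_apply : ∀ x, Fc (ax x) = F (ax x + c) := by
    intro x
    rw [hFc, SchwartzMap.compSubConstCLM_apply, sub_neg_eq_add]
  -- (1) the decomposition into a shift part over the box and a slice part
  have hdecomp : (∑ x ∈ D, ((W x : ℝ) : ℂ) * F (ax x + c)) - ∑ x ∈ B, ((W x : ℝ) : ℂ) * F (ax x) =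
      (∑ x ∈ B, ((W x : ℝ) : ℂ) * (F (ax x + c) - F (ax x))) -
        ∑ x ∈ B \ D, ((W x : ℝ) : ℂ) * Fc (ax x) := by
    have hsplit := Finset.sum_sdiff (f := fun x => ((W x : ℝ) : ℂ) * F (ax x + c)) hD
    simp only [hFc_apply, mul_sub, Finset.sum_sub_distrib]
    rw [← hsplit]
    ring
  -- (2) the shift part: the intermediate points are within `a` of the scaled sites
  have hnear : ∀ (τ : (Fin n → Site 4) → ℝ), (∀ x, τ x ∈ Set.Ioo (0 : ℝ) 1) →
      ∀ x l, ‖(ax x + τ x • c) l - a • siteToE (x l)‖ ≤ a := by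
    intro τ hτ x l
    have h1 : (ax x + τ x • c) l - a • siteToE (x l) = τ x • c l := by
      simp only [hax, Pi.add_apply, Pi.smul_apply, add_sub_cancel_left]
    rw [h1, norm_smul, Real.norm_of_nonneg (hτ x).1.le]
    calc τ x * ‖c l‖ ≤ 1 * ‖c l‖ := by gcongr; exact (hτ x).2.le
      _ ≤ a := by rw [one_mul]; exact hc l
  have hF'off : IsOffDiagonal F' := by rw [hF']; exact hF.lineDeriv c
  have hU₁ : ‖∑ x ∈ B, ((W x : ℝ) : ℂ) * F' (ax x + τ₁ x • c)‖ ≤ Φ * schwartzNorm s F' :=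
    hU (fun x => ax x + τ₁ x • c) (hnear τ₁ hτ₁) F' hF'off
  have hU₂ : ‖∑ x ∈ B, ((W x : ℝ) : ℂ) * F' (ax x + τ₂ x • c)‖ ≤ Φ * schwartzNorm s F' :=
    hU (fun x => ax x + τ₂ x • c) (hnear τ₂ hτ₂) F' hF'off
  have hsn : schwartzNorm s F' ≤ a * schwartzNorm (s + 1) F :=
    calc schwartzNorm s F' ≤ ‖c‖ * schwartzNorm (s + 1) F := by
          rw [hF']; exact slS_schwartzNorm_lineDeriv_le s F c
      _ ≤ a * schwartzNorm (s + 1) F := mul_le_mul_of_nonneg_right hcn hsN0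
  have hshift : ‖∑ x ∈ B, ((W x : ℝ) : ℂ) * (F (ax x + c) - F (ax x))‖ ≤
      2 * Φ * (a * schwartzNorm (s + 1) F) := by
    set z := ∑ x ∈ B, ((W x : ℝ) : ℂ) * (F (ax x + c) - F (ax x)) with hz
    have hzre : z.re = (∑ x ∈ B, ((W x : ℝ) : ℂ) * F' (ax x + τ₁ x • c)).re := by
      rw [hz, Complex.re_sum, Complex.re_sum]
      refine Finset.sum_congr rfl fun x _ => ?_
      simp only [Complex.mul_re, Complex.ofReal_re, Complex.ofReal_im, zero_mul, sub_zero,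
        Complex.sub_re]
      rw [hτ₁eq x]
    have hzim : z.im = (∑ x ∈ B, ((W x : ℝ) : ℂ) * F' (ax x + τ₂ x • c)).im := by
      rw [hz, Complex.im_sum, Complex.im_sum]
      refine Finset.sum_congr rfl fun x _ => ?_
      simp only [Complex.mul_im, Complex.ofReal_re, Complex.ofReal_im, zero_mul, add_zero,
        Complex.sub_im]
      rw [hτ₂eq x]
    calc ‖z‖ ≤ |z.re| + |z.im| := Complex.norm_le_abs_re_add_abs_im z
      _ ≤ ‖∑ x ∈ B, ((W x : ℝ) : ℂ) * F' (ax x + τ₁ x • c)‖ +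
            ‖∑ x ∈ B, ((W x : ℝ) : ℂ) * F' (ax x + τ₂ x • c)‖ := by
          rw [hzre, hzim]
          exact add_le_add (Complex.abs_re_le_norm _) (Complex.abs_im_le_norm _)
      _ ≤ Φ * schwartzNorm s F' + Φ * schwartzNorm s F' := add_le_add hU₁ hU₂
      _ ≤ Φ * (a * schwartzNorm (s + 1) F) + Φ * (a * schwartzNorm (s + 1) F) :=
          add_le_add (mul_le_mul_of_nonneg_left hsn hΦ) (mul_le_mul_of_nonneg_left hsn hΦ)
      _ = 2 * Φ * (a * schwartzNorm (s + 1) F) := by ring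
  -- (3) the slice part
  have hslice : ‖∑ x ∈ B \ D, ((W x : ℝ) : ℂ) * Fc (ax x)‖ ≤
      M ^ n * 2 ^ (16 * n + 2) * Z ^ n * (4 ^ (10 * n + 1) * schwartzNorm (10 * n + 1) F) * a := by
    have h : ‖∑ x ∈ B \ D, ((W x : ℝ) : ℂ) * Fc (ax x)‖ ≤
        M ^ n * 2 ^ (16 * n + 2) * Z ^ n * SchwartzMap.seminorm ℂ (10 * n + 1) 0 Fc * a :=
      rpBlock_boundarySlice n L M a W D Fc hM hW ha ha1 hLa hD hfar
    have hsemi : SchwartzMap.seminorm ℂ (10 * n + 1) 0 Fc ≤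
        4 ^ (10 * n + 1) * schwartzNorm (10 * n + 1) F := by
      rw [hFc]; exact slS_seminorm_translate_le (10 * n + 1) F hcn1
    have hK0 : 0 ≤ M ^ n * 2 ^ (16 * n + 2) * Z ^ n :=
      mul_nonneg (mul_nonneg (pow_nonneg hM _) (pow_nonneg (by norm_num) _)) (pow_nonneg hZ0 _)
    exact h.trans (mul_le_mul_of_nonneg_right (mul_le_mul_of_nonneg_left hsemi hK0) ha.le)
  -- (4) assemble
  rw [hdecomp]
  calc ‖(∑ x ∈ B, ((W x : ℝ) : ℂ) * (F (ax x + c) - F (ax x))) -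
          ∑ x ∈ B \ D, ((W x : ℝ) : ℂ) * Fc (ax x)‖
      ≤ ‖∑ x ∈ B, ((W x : ℝ) : ℂ) * (F (ax x + c) - F (ax x))‖ +
          ‖∑ x ∈ B \ D, ((W x : ℝ) : ℂ) * Fc (ax x)‖ := norm_sub_le _ _
    _ ≤ 2 * Φ * (a * schwartzNorm (s + 1) F) +
          M ^ n * 2 ^ (16 * n + 2) * Z ^ n * (4 ^ (10 * n + 1) * schwartzNorm (10 * n + 1) F) * a :=
        add_le_add hshift hslice
    _ = a * (2 * Φ * schwartzNorm (s + 1) F +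
          M ^ n * 2 ^ (16 * n + 2) * Z ^ n * 4 ^ (10 * n + 1) * schwartzNorm (10 * n + 1) F) := by
        ring

end Summit.QuantumFields.YangMills.Cruxes.HypercubicLimit.ConditionalMeanTelescoping

end
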